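import Literature.AnabelianGeometry.AbsoluteAnabelian.AbsTopIChains
import HarnessLib

/-!
# [AbsTopI] Def 4.2 (iii)–(iv): the rigidity consequences of slimness — uniqueness of `Πⱼ ↠ Gⱼ`,
# operation homomorphisms are over `G`, automorphisms of a `Π`-chain are trivial (proof-only)

S. Mochizuki, *Topics in Absolute Anabelian Geometry I: Generalities* (2012) [AbsTopI] §4, Def 4.2,
manuscript pagination (lit key `paper:url-11ac98ba15fc`).  Two bracketed assertions of the print that
the typing of `AbsTopIChains.lean` (abc-iut-L4-t4) records only as data/predicates are PROVED here from
the standing hypothesis "Let `G` be a slim profinite group" (Def 4.2, p. 47 l. 8) and the slimness of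
the terms `Πⱼ` (Def 4.2 (iii), p. 49 l. 16 "of slim profinite groups `Πⱼ`"):

* p. 49 l. 21–23, (1_Π): "There exists a [uniquely determined] surjection `Πⱼ ↠ Gⱼ`, where `Gⱼ ⊆ G`
  is an open subgroup, that is compatible with `ρⱼ` and the natural composite morphism
  `Π̃ → Π ↠ G`" — UNIQUENESS: `ChainGroup.proj_unique` (any continuous `Πⱼ → G` compatible with `ρⱼ`
  and `Π̃ → Π ↠ G` is the structure's `proj`, for `G` slim);
* p. 50 l. 28–31 (Def 4.2 (iv)): "the condition of compatibility with the rigidifying homomorphisms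
  implies [since all of the profinite groups involved are slim] that every automorphism of a
  `Π`-chain is given by the identity" — termwise: `ChainGroup.eq_id_of_rigCompat` (an endomorphism of
  `Πⱼ` compatible with `ρⱼ` in the sense of `RigCompat` is the identity; slimness of `Πⱼ` only);
* the mechanism behind both, and behind "every isomorphism of `Π`-chains is compatible with the
  respective operation homomorphisms" (same bracket): two homomorphisms into a slim group that agree
  on an open subgroup, one of which carries open subgroups to open subgroups, are EQUAL
  (`IsSlimGroup.eq_of_eqOn_of_isOpen_map`); whence every operation homomorphism `φ : Πⱼ → Πⱼ₊₁`
  compatible with the rigidifying homomorphisms (`RigCompat`, [AbsTopI] Def 4.2 (iii) (a)–(d)) lies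
  OVER `G`: `Gⱼ₊₁`-projection ∘ `φ` = `Gⱼ`-projection (`ChainGroup.RigCompat.proj_comp_apply`), so
  `φ(Δⱼ) ⊆ Δⱼ₊₁` (`ChainGroup.RigCompat.map_geomJ_le`).

Supporting topological-group facts (our kernel check of classical statements): the augmentation
`Π ↠ G` of an extension of profinite groups is an open quotient map
(`FundamentalExtension.isOpenMap_aug`); the rigidifying homomorphism `ρⱼ` and the projection
`Πⱼ → G` carry open subgroups to open subgroups (`ChainGroup.isOpen_map_rig`, `isOpen_map_proj`).

abc-iut cell bookkeeping: companion of FACT-LIST row F-0215 (`ChainGroup.RigCompat`, [AbsTopI] Def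
4.2 (iii) p. 49; schema certificate `AbsTopIChainsSchemaClosures.lean`): the printed CONSEQUENCES of
the predicate.  Proof-only (no `def`); `AbsTopIChains.lean` is imported, not edited.  Nothing here
bears on [IUTchIII] Cor 3.12; no side is taken.
-/

noncomputable section

open Topology
open scoped Pointwise

universe u v

/-! ### Slim rigidity for a pair of homomorphisms -/

/-- **Slim rigidity, two-homomorphism form.**  Let `G` be slim, `f f' : A → G` homomorphisms from a
topological group that AGREE on an open subgroup `H ⊆ A`, and suppose `f` carries open subgroups of
`A` to open subgroups of `G`.  Then `f = f'`: for `g ∈ A` and `n` in the open subgroup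
`K = H ∩ g⁻¹Hg`, `f(gng⁻¹) = f'(gng⁻¹)` gives that `f'(g)⁻¹f(g)` centralises the open subgroup
`f(K)`, hence is trivial ([FrdI] §0 p. 13 "slim"; the argument of [AbsTopI] Def 4.2 (iv) p. 50
"[since all of the profinite groups involved are slim]"). [cite: MochizukiAbsTopI2012, Def 4.2 (iv) p.50] -/
theorem Literature.AlgebraicGeometry.Frobenioids.IsSlimGroup.eq_of_eqOn_of_isOpen_map
    {G : Type u} [Group G] [TopologicalSpace G]
    (hG : Literature.AlgebraicGeometry.Frobenioids.IsSlimGroup G)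
    {A : Type v} [Group A] [TopologicalSpace A] [IsTopologicalGroup A] (f f' : A →* G)
    (hf : ∀ K : Subgroup A, IsOpen (K : Set A) → IsOpen ((K.map f : Subgroup G) : Set G))
    {H : Subgroup A} (hH : IsOpen (H : Set A)) (h : ∀ x ∈ H, f x = f' x) (g : A) :
    f g = f' g := by
  -- the open subgroup `K = H ∩ g⁻¹ H g = {n ∈ H | g n g⁻¹ ∈ H}`
  let K : Subgroup A := H ⊓ H.comap (MulAut.conj g).toMonoidHom
  have hK : IsOpen (K : Set A) := by
    change IsOpen ((H : Set A) ∩ (fun n => (MulAut.conj g).toMonoidHom n) ⁻¹' (H : Set A))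
    refine hH.inter (hH.preimage ?_)
    change Continuous fun n : A => g * n * g⁻¹
    fun_prop
  have hc : (f' g)⁻¹ * f g ∈ Subgroup.centralizer ((K.map f : Subgroup G) : Set G) := by
    rw [Subgroup.mem_centralizer_iff]
    intro y hy
    rw [SetLike.mem_coe] at hy
    obtain ⟨n, hn, rfl⟩ := Subgroup.mem_map.1 hy
    obtain ⟨hnH, hgn⟩ := Subgroup.mem_inf.1 hn
    have hgn' : g * n * g⁻¹ ∈ H := hgn
    have e1 : f (g * n * g⁻¹) = f' (g * n * g⁻¹) := h _ hgn'
    rw [map_mul, map_mul, map_inv, map_mul, map_mul, map_inv, ← h n hnH] at e1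
    -- `e1 : f g * f n * (f g)⁻¹ = f' g * f n * (f' g)⁻¹`
    calc f n * ((f' g)⁻¹ * f g) = (f' g)⁻¹ * (f' g * f n * (f' g)⁻¹) * f g := by group
      _ = (f' g)⁻¹ * (f g * f n * (f g)⁻¹) * f g := by rw [e1]
      _ = (f' g)⁻¹ * f g * f n := by group
  rw [hG.centralizer_eq_bot _ (hf K hK), Subgroup.mem_bot] at hc
  exact (inv_mul_eq_one.1 hc).symm

namespace Literature.AnabelianGeometry.AbsoluteAnabelian

open Literature.AlgebraicGeometry.Frobenioids (IsSlimGroup)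

namespace FundamentalExtension

variable (E : FundamentalExtension.{u})

/-! ### The augmentation `Π ↠ G` is an open quotient map -/

/-- The augmentation `Π ↠ G` of an extension of profinite groups is a quotient map (a continuous
surjection from a compact space onto a Hausdorff space is closed).
[cite: MochizukiAbsTopIII2015, Thm 1.9 p.37] -/
theorem isQuotientMap_aug : IsQuotientMap E.aug :=
  IsClosedMap.isQuotientMap (map_continuous E.aug).isClosedMap (map_continuous E.aug)
    E.aug_surjective

/-- The augmentation `Π ↠ G` is an OPEN map (a quotient homomorphism of topological groups is open).
[cite: MochizukiAbsTopIII2015, Thm 1.9 p.37] -/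
theorem isOpenMap_aug : IsOpenMap E.aug :=
  (MonoidHom.isOpenQuotientMap_of_isQuotientMap (φ := E.aug) E.isQuotientMap_aug).isOpenMap

variable {E}

namespace ChainGroup

/-! ### Openness of `ρⱼ` and of `Πⱼ → G` on subgroups -/

/-- The rigidifying homomorphism `ρⱼ` carries open subgroups of its (open, hence compact) domain to
open subgroups of `Πⱼ`: `ρⱼ` is a quotient map onto its open image.
[cite: MochizukiAbsTopI2012, Def 4.2 (iii) p.49] -/
theorem isOpen_map_rig (L : E.ChainGroup) (U : Subgroup L.dom) (hU : IsOpen (U : Set L.dom)) :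
    IsOpen ((U.map L.rig.toMonoidHom : Subgroup L.grp) : Set L.grp) := by
  -- `dom` is an open, hence closed, hence compact subgroup of the profinite `Π`
  haveI : CompactSpace L.dom :=
    isCompact_iff_compactSpace.mp (Subgroup.isClosed_of_isOpen _ L.isOpen_dom).isCompact
  -- `ρⱼ` co-restricted to its range is a quotient map of topological groups, hence open
  let r : L.dom →* L.rig.toMonoidHom.range := L.rig.toMonoidHom.rangeRestrict
  have hrc : Continuous r := continuous_induced_rng.2 (map_continuous L.rig)
  have hrq : IsQuotientMap r :=
    IsClosedMap.isQuotientMap hrc.isClosedMap hrc L.rig.toMonoidHom.rangeRestrict_surjective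
  have hro : IsOpenMap r := (MonoidHom.isOpenQuotientMap_of_isQuotientMap (φ := r) hrq).isOpenMap
  -- the range is open in `Πⱼ`, so the inclusion of the range is an open map
  have hRo : IsOpen ((L.rig.toMonoidHom.range : Subgroup L.grp) : Set L.grp) := by
    rw [MonoidHom.coe_range]
    exact L.isOpen_range_rig
  have himage : ((U.map L.rig.toMonoidHom : Subgroup L.grp) : Set L.grp) =
      Subtype.val '' (r '' (U : Set L.dom)) := by
    rw [Subgroup.coe_map, ← Set.image_comp]
    rfl
  rw [himage]
  exact hRo.isOpenMap_subtype_val _ (hro _ hU)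

/-- The projection `Πⱼ → G` carries open subgroups of `Πⱼ` to open subgroups of `G`: for `K ⊆ Πⱼ`
open, `proj(K) ⊇ aug(ρⱼ⁻¹(K))`, an open subgroup of `G` (compatibility (1_Π) of `Πⱼ ↠ Gⱼ` with `ρⱼ`
and `Π̃ → Π ↠ G`; `Π ↠ G` is open). [cite: MochizukiAbsTopI2012, Def 4.2 (iii) p.49] -/
theorem isOpen_map_proj (L : E.ChainGroup) (K : Subgroup L.grp) (hK : IsOpen (K : Set L.grp)) :
    IsOpen ((K.map L.proj.toMonoidHom : Subgroup E.gal) : Set E.gal) := by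
  -- `T := aug (ρⱼ⁻¹ K)` is an open subgroup of `G` contained in `proj K`
  let K' : Subgroup L.dom := K.comap L.rig.toMonoidHom
  have hK' : IsOpen (K' : Set L.dom) := by
    rw [Subgroup.coe_comap]
    exact hK.preimage (map_continuous L.rig)
  have hK'' : IsOpen ((K'.map L.dom.subtype : Subgroup E.arith) : Set E.arith) := by
    rw [Subgroup.coe_map]
    exact L.isOpen_dom.isOpenMap_subtype_val _ hK'
  have hT : IsOpen ((((K'.map L.dom.subtype).map E.aug.toMonoidHom : Subgroup E.gal)) : Set E.gal) := by
    rw [Subgroup.coe_map]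
    exact E.isOpenMap_aug _ hK''
  refine Subgroup.isOpen_mono ?_ hT
  rintro _ ⟨y, hy, rfl⟩
  obtain ⟨x, hx, rfl⟩ := Subgroup.mem_map.1 hy
  refine ⟨L.rig x, hx, ?_⟩
  exact L.comm x

/-! ### (1_Π): the surjection `Πⱼ ↠ Gⱼ ⊆ G` is uniquely determined -/

/-- **[AbsTopI] Def 4.2 (iii) (1_Π), "[uniquely determined]"** (p. 49 l. 21–23): for `G` slim (the
standing hypothesis of Def 4.2, p. 47 l. 8), a continuous homomorphism `Πⱼ → G` compatible with `ρⱼ`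
and the composite `Π̃ → Π ↠ G` IS the projection `Πⱼ ↠ Gⱼ ⊆ G` recorded in the chain term — two such
maps agree on the open image of `ρⱼ`, and the recorded one is open on subgroups.
[cite: MochizukiAbsTopI2012, Def 4.2 (iii) p.49] -/
theorem proj_unique (hG : IsSlimGroup E.gal) (L : E.ChainGroup) (p : L.grp →ₜ* E.gal)
    (hp : ∀ x : L.dom, p (L.rig x) = E.aug x) : p = L.proj := by
  have hRo : IsOpen ((L.rig.toMonoidHom.range : Subgroup L.grp) : Set L.grp) := by
    rw [MonoidHom.coe_range]
    exact L.isOpen_range_rig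
  have key := hG.eq_of_eqOn_of_isOpen_map L.proj.toMonoidHom p.toMonoidHom L.isOpen_map_proj hRo
    (by
      rintro _ ⟨x, rfl⟩
      exact (L.comm x).trans (hp x).symm)
  ext g
  exact (key g).symm

/-! ### Operation homomorphisms compatible with the rigidifying homomorphisms lie over `G` -/

/-- For `G` slim: an operation homomorphism `φ : Πⱼ → Πⱼ₊₁` compatible with the rigidifying
homomorphisms ([AbsTopI] Def 4.2 (iii), `RigCompat`) commutes with the projections to `G`:
`(Πⱼ₊₁ → G) ∘ φ = (Πⱼ → G)` — both agree with `Π̃ → Π ↠ G` on the open subgroup `ρⱼ(U)`.  (This is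
why the `Gⱼ` of a `Π`-chain form a chain of open subgroups of `G`, and why "every isomorphism of
`Π`-chains is compatible with" the structure over `G`, Def 4.2 (iv) p. 50.)
[cite: MochizukiAbsTopI2012, Def 4.2 (iii) p.49] -/
theorem RigCompat.proj_comp_apply (hG : IsSlimGroup E.gal) {L L' : E.ChainGroup}
    {φ : L.grp →ₜ* L'.grp} (h : RigCompat L L' φ) (y : L.grp) : L'.proj (φ y) = L.proj y := by
  obtain ⟨U, hUo, hU, hU', hφ⟩ := h
  -- the open subgroup `ρⱼ(U)` of `Πⱼ`
  let U₀ : Subgroup L.dom := U.comap L.dom.subtype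
  have hU₀ : IsOpen (U₀ : Set L.dom) := by
    rw [Subgroup.coe_comap]
    exact hUo.preimage continuous_subtype_val
  have hHo := L.isOpen_map_rig U₀ hU₀
  have key := hG.eq_of_eqOn_of_isOpen_map L.proj.toMonoidHom (L'.proj.toMonoidHom.comp φ.toMonoidHom)
    L.isOpen_map_proj hHo (by
      rintro _ ⟨x, hx, rfl⟩
      have hxU : (x : E.arith) ∈ U := hx
      change L.proj (L.rig x) = L'.proj (φ (L.rig x))
      have e1 : L.rig x = L.rig ⟨x, hU hxU⟩ := rfl
      rw [L.comm x, e1, hφ ⟨x, hxU⟩, L'.comm])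
  exact (key y).symm

/-- Hence such a `φ` carries `Δⱼ = Ker(Πⱼ → G)` into `Δⱼ₊₁` (for `G` slim).
[cite: MochizukiAbsTopI2012, Def 4.2 (iii) p.49] -/
theorem RigCompat.map_geomJ_le (hG : IsSlimGroup E.gal) {L L' : E.ChainGroup}
    {φ : L.grp →ₜ* L'.grp} (h : RigCompat L L' φ) : L.geomJ.map φ.toMonoidHom ≤ L'.geomJ := by
  rintro _ ⟨y, hy, rfl⟩
  have hy' : L.proj y = 1 := hy
  show L'.proj (φ y) = 1
  rw [h.proj_comp_apply hG, hy']

/-- And the image `Gⱼ` of `Πⱼ` in `G` is contained in the image `Gⱼ₊₁` of `Πⱼ₊₁` (for `G` slim).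
[cite: MochizukiAbsTopI2012, Def 4.2 (iii) p.49] -/
theorem RigCompat.range_proj_subset (hG : IsSlimGroup E.gal) {L L' : E.ChainGroup}
    {φ : L.grp →ₜ* L'.grp} (h : RigCompat L L' φ) : Set.range L.proj ⊆ Set.range L'.proj := by
  rintro _ ⟨y, rfl⟩
  exact ⟨φ y, h.proj_comp_apply hG y⟩

/-! ### Def 4.2 (iv): automorphisms of a `Π`-chain are trivial -/

/-- **[AbsTopI] Def 4.2 (iv), "every automorphism of a `Π`-chain is given by the identity"**
(p. 50 l. 28–31), termwise: an endomorphism `ψ` of a term `Πⱼ` that is compatible with the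
rigidifying homomorphism `ρⱼ` (`RigCompat`) is the identity — it fixes the open subgroup `ρⱼ(U)`
pointwise and `Πⱼ` is slim. [cite: MochizukiAbsTopI2012, Def 4.2 (iv) p.50] -/
theorem eq_id_of_rigCompat (L : E.ChainGroup) {ψ : L.grp →ₜ* L.grp} (h : RigCompat L L ψ) :
    ψ = ContinuousMonoidHom.id L.grp := by
  obtain ⟨U, hUo, hU, hU', hψ⟩ := h
  let U₀ : Subgroup L.dom := U.comap L.dom.subtype
  have hU₀ : IsOpen (U₀ : Set L.dom) := by
    rw [Subgroup.coe_comap]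
    exact hUo.preimage continuous_subtype_val
  have hHo := L.isOpen_map_rig U₀ hU₀
  have hid : ∀ K : Subgroup L.grp, IsOpen (K : Set L.grp) →
      IsOpen ((K.map (MonoidHom.id L.grp) : Subgroup L.grp) : Set L.grp) := fun K hK => by
    rwa [Subgroup.map_id]
  have key := L.slim.eq_of_eqOn_of_isOpen_map (MonoidHom.id L.grp) ψ.toMonoidHom hid hHo (by
      rintro _ ⟨x, hx, rfl⟩
      have hxU : (x : E.arith) ∈ U := hx
      change L.rig x = ψ (L.rig x)
      have e1 : L.rig x = L.rig ⟨x, hU hxU⟩ := rfl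
      rw [e1, hψ ⟨x, hxU⟩])
  ext g
  exact (key g).symm

/-- In particular the only RIGIDIFIED automorphism of a term is the identity: a bicontinuous
automorphism `e : Πⱼ ≅ Πⱼ` compatible with `ρⱼ` is `1` ([AbsTopI] Def 4.2 (iv) p. 50).
[cite: MochizukiAbsTopI2012, Def 4.2 (iv) p.50] -/
theorem continuousMulEquiv_eq_refl_of_rigCompat (L : E.ChainGroup) (e : L.grp ≃ₜ* L.grp)
    (h : RigCompat L L (e : L.grp →ₜ* L.grp)) : e = ContinuousMulEquiv.refl L.grp := by
  have key := L.eq_id_of_rigCompat h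
  ext g
  exact DFunLike.congr_fun key g

end ChainGroup

end FundamentalExtension

end Literature.AnabelianGeometry.AbsoluteAnabelian

end
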